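import Summits.Ventures.PercRepro.Night2LocalRuleFair

/-!
# PercRepro — the three-layer rule with FAIR-SHARE loss routing: a per-loss certificate (night-2, gen 18)

The three-layer rule of `Night2LocalRuleDefs` (layer 0 exact, layer 1 = the covering requests served at the
fraction `fS`) with a new layer 2: the loss `loss B z` of the thin member `B` at its covering set `B ∪ {z}` is
spread over ALL the far spanning supersets of `B` through `z` (`tgtSets B z` = the shadow sets `S ⊇ B ∪ {z}` with
closure `G` and `|S ∖ B| ≥ 2` — exact traces and hull sets alike, at every distance), the set `S` receiving the share
`cap2 S / pi2Mass S` relative to the weight `rhoL B z = loss B z / #tgtSets B z`, where `pi2Mass S` is the total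
weight of the losses targeting `S`.  Rows are exact (`sum_w2F_row`: the shares are normalised by
`lossIncome B z = Σ_{S ∈ tgtSets B z} cap2 S / pi2Mass S`), and the layer-2 column sum at `S` is at most `cap2 S`
as soon as every loss satisfies the PER-LOSS inequality `loss B z ≤ rhoL B z · lossIncome B z`
(`sum_w2F_col_le`) — the same mechanism as `Night2LocalRuleFair`, one level down.
**`localShadowHall_of_lossFair`**: with `|E ∖ G| ≤ q`, that per-loss inequality at every thin member `B` and every
`z ∈ G ∖ cl B` gives (LI_G) at `G`.  Numerically (proofs/NIGHT-2-g18.md §6) the inequality holds with ratio `≥ 3`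
on every instance tested: all eight open cells of the `(7,5)` row, the rigid cell at `q = 5 … 10`, the nested
lines, the structured adversaries of gen 17 and the catalogue of all matroids on `≤ 8` elements.
-/

namespace PercRepro.Shadow

open Finset PerFlat ThmH

variable {α : Type*} [DecidableEq α] {M : Matroid α} [M.Finite]

/-! ## The ingredients -/

open scoped Classical in
/-- The targets of the loss of `B` at `z`: the shadow sets `S ⊇ B ∪ {z}` with closure `G` and `|S ∖ B| ≥ 2`. -/
noncomputable def tgtSets (M : Matroid α) [M.Finite] (q : ℕ) (G B : Finset α) (z : α) : Finset (Finset α) :=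
  (shadowAt M (q + 2) q (Uq M (q + 2) q) G).filter (fun S => insert z B ⊆ S ∧ 2 ≤ (S \ B).card)

/-- The weight of the loss of `B` at `z`: `loss B z / #tgtSets B z`. -/
noncomputable def rhoL (M : Matroid α) [M.Finite] (q : ℕ) (G B : Finset α) (z : α) : ℚ :=
  loss M q G B z / ((tgtSets M q G B z).card : ℚ)

open scoped Classical in
/-- The total loss weight targeting `S`. -/
noncomputable def pi2Mass (M : Matroid α) [M.Finite] (q : ℕ) (G S : Finset α) : ℚ :=
  ∑ B ∈ thinMembers M q G, ∑ z ∈ G \ clF M B, if S ∈ tgtSets M q G B z then rhoL M q G B z else 0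

/-- The fair-share income of the loss of `B` at `z`. -/
noncomputable def lossIncome (M : Matroid α) [M.Finite] (q : ℕ) (G B : Finset α) (z : α) : ℚ :=
  ∑ S ∈ tgtSets M q G B z, cap2 M q G S / pi2Mass M q G S

/-- The share of the loss of `B` at `z` received by `S`. -/
noncomputable def shareL (M : Matroid α) [M.Finite] (q : ℕ) (G B : Finset α) (z : α) (S : Finset α) : ℚ :=
  if loss M q G B z = 0 then 0
  else loss M q G B z * (cap2 M q G S / pi2Mass M q G S) / lossIncome M q G B z

open scoped Classical in
/-- Layer 2 with fair-share routing. -/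
noncomputable def w2F (M : Matroid α) [M.Finite] (q : ℕ) (G B S : Finset α) : ℚ :=
  if B ∈ thinMembers M q G then
    ∑ z ∈ G \ clF M B, if S ∈ tgtSets M q G B z then shareL M q G B z S else 0
  else 0

/-- The whole rule: layers 0, 1 and the fair-share layer 2. -/
noncomputable def wLossFair (M : Matroid α) [M.Finite] (q : ℕ) (G B S : Finset α) : ℚ :=
  w0 M q G B S + w1 M q G B S + w2F M q G B S

/-! ## Membership and positivity -/

open scoped Classical in
/-- Membership in `tgtSets`. -/
theorem mem_tgtSets {q : ℕ} {G B S : Finset α} {z : α} :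
    S ∈ tgtSets M q G B z ↔
      S ∈ shadowAt M (q + 2) q (Uq M (q + 2) q) G ∧ insert z B ⊆ S ∧ 2 ≤ (S \ B).card := by
  unfold tgtSets; rw [Finset.mem_filter]

/-- Losses are nonnegative when `|E ∖ G| ≤ q`. -/
theorem loss_nonneg' {q : ℕ} {G : Finset α} (hG : G ∈ flatsQ M (q + 1)) (hd : (gr M \ G).card ≤ q)
    (B : Finset α) (z : α) : 0 ≤ loss M q G B z :=
  loss_nonneg (capS_nonneg' hG hd _)

/-- The loss weights are nonnegative. -/
theorem rhoL_nonneg {q : ℕ} {G : Finset α} (hG : G ∈ flatsQ M (q + 1)) (hd : (gr M \ G).card ≤ q)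
    (B : Finset α) (z : α) : 0 ≤ rhoL M q G B z := by
  unfold rhoL
  exact div_nonneg (loss_nonneg' hG hd B z) (by positivity)

open scoped Classical in
/-- The loss mass at `S` is nonnegative. -/
theorem pi2Mass_nonneg {q : ℕ} {G : Finset α} (hG : G ∈ flatsQ M (q + 1)) (hd : (gr M \ G).card ≤ q)
    (S : Finset α) : 0 ≤ pi2Mass M q G S := by
  unfold pi2Mass
  apply Finset.sum_nonneg; intro B _
  apply Finset.sum_nonneg; intro z _
  split_ifs
  · exact rhoL_nonneg hG hd B z
  · exact le_refl _

/-- The loss incomes are nonnegative. -/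
theorem lossIncome_nonneg {q : ℕ} {G : Finset α} (hG : G ∈ flatsQ M (q + 1)) (hd : (gr M \ G).card ≤ q)
    (B : Finset α) (z : α) : 0 ≤ lossIncome M q G B z := by
  unfold lossIncome
  exact Finset.sum_nonneg (fun S _ => div_nonneg (cap2_nonneg (capS_nonneg' hG hd S)) (pi2Mass_nonneg hG hd S))

/-- Under the per-loss condition a positive loss has positive weight and positive income. -/
theorem lossIncome_pos {q : ℕ} {G : Finset α} (hG : G ∈ flatsQ M (q + 1)) (hd : (gr M \ G).card ≤ q)
    {B : Finset α} {z : α} (hl : loss M q G B z ≠ 0)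
    (hcond : loss M q G B z ≤ rhoL M q G B z * lossIncome M q G B z) :
    0 < rhoL M q G B z ∧ 0 < lossIncome M q G B z := by
  have hl' : 0 < loss M q G B z := lt_of_le_of_ne (loss_nonneg' hG hd B z) (Ne.symm hl)
  have h1 := rhoL_nonneg hG hd B z
  have h2 := lossIncome_nonneg hG hd B z
  refine ⟨?_, ?_⟩
  · rcases h1.lt_or_eq with h | h
    · exact h
    · rw [← h, zero_mul] at hcond; exact absurd hcond (not_le.2 hl')
  · rcases h2.lt_or_eq with h | h
    · exact h
    · rw [← h, mul_zero] at hcond; exact absurd hcond (not_le.2 hl')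

/-- Shares are nonnegative. -/
theorem shareL_nonneg {q : ℕ} {G : Finset α} (hG : G ∈ flatsQ M (q + 1)) (hd : (gr M \ G).card ≤ q)
    (B : Finset α) (z : α) (S : Finset α) : 0 ≤ shareL M q G B z S := by
  unfold shareL
  split_ifs
  · exact le_refl _
  · exact div_nonneg (mul_nonneg (loss_nonneg' hG hd B z)
      (div_nonneg (cap2_nonneg (capS_nonneg' hG hd S)) (pi2Mass_nonneg hG hd S))) (lossIncome_nonneg hG hd B z)

open scoped Classical in
/-- Layer 2 is nonnegative. -/
theorem w2F_nonneg {q : ℕ} {G : Finset α} (hG : G ∈ flatsQ M (q + 1)) (hd : (gr M \ G).card ≤ q)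
    (B S : Finset α) : 0 ≤ w2F M q G B S := by
  unfold w2F
  split_ifs
  · apply Finset.sum_nonneg; intro z _
    split_ifs
    · exact shareL_nonneg hG hd B z S
    · exact le_refl _
  · exact le_refl _

open scoped Classical in
/-- Layer 2 is supported on containment. -/
theorem subset_of_w2F_ne {q : ℕ} {G B S : Finset α} (h : w2F M q G B S ≠ 0) : B ⊆ S := by
  unfold w2F at h
  split_ifs at h with hB
  · obtain ⟨z, -, hz⟩ := Finset.exists_ne_zero_of_sum_ne_zero h
    split_ifs at hz with hS
    · exact (Finset.subset_insert z B).trans (mem_tgtSets.1 hS).2.1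
    · exact absurd rfl hz
  · exact absurd rfl h

open scoped Classical in
/-- The rule is supported on containment. -/
theorem subset_of_wLossFair_ne {q : ℕ} {G B S : Finset α} (h : wLossFair M q G B S ≠ 0) : B ⊆ S := by
  unfold wLossFair at h
  by_cases h0 : w0 M q G B S = 0
  · by_cases h1 : w1 M q G B S = 0
    · rw [h0, h1, zero_add, zero_add] at h
      exact subset_of_w2F_ne h
    · exact subset_of_w1_ne h1
  · exact subset_of_w0_ne h0

/-! ## Rows -/

open scoped Classical in
/-- The shares of one loss sum to the loss (under the per-loss condition). -/
theorem sum_shareL {q : ℕ} {G : Finset α} (hG : G ∈ flatsQ M (q + 1)) (hd : (gr M \ G).card ≤ q)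
    {B : Finset α} {z : α} (hcond : loss M q G B z ≤ rhoL M q G B z * lossIncome M q G B z) :
    ∑ S ∈ tgtSets M q G B z, shareL M q G B z S = loss M q G B z := by
  unfold shareL
  by_cases hl : loss M q G B z = 0
  · simp [hl]
  · have hN : lossIncome M q G B z ≠ 0 := (lossIncome_pos hG hd hl hcond).2.ne'
    simp only [hl, if_false]
    have hterm : ∀ S ∈ tgtSets M q G B z,
        loss M q G B z * (cap2 M q G S / pi2Mass M q G S) / lossIncome M q G B z =
        (loss M q G B z / lossIncome M q G B z) * (cap2 M q G S / pi2Mass M q G S) := by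
      intro S _; ring
    rw [Finset.sum_congr rfl hterm, ← Finset.mul_sum]
    unfold lossIncome at hN ⊢
    field_simp

open scoped Classical in
/-- The row sum of layer 2 for a thin member is its total loss. -/
theorem sum_w2F_row {q : ℕ} {G : Finset α} (hG : G ∈ flatsQ M (q + 1)) (hd : (gr M \ G).card ≤ q)
    {B : Finset α} (hB : B ∈ thinMembers M q G)
    (hcond : ∀ z ∈ G \ clF M B, loss M q G B z ≤ rhoL M q G B z * lossIncome M q G B z) :
    ∑ S ∈ shadowAt M (q + 2) q (Uq M (q + 2) q) G, w2F M q G B S =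
      ∑ z ∈ G \ clF M B, loss M q G B z := by
  unfold w2F
  simp only [hB, if_true]
  rw [Finset.sum_comm]
  apply Finset.sum_congr rfl
  intro z hz
  rw [← Finset.sum_filter]
  have hsub : tgtSets M q G B z ⊆ shadowAt M (q + 2) q (Uq M (q + 2) q) G :=
    fun S hS => (mem_tgtSets.1 hS).1
  rw [Finset.filter_mem_eq_inter, Finset.inter_eq_right.2 hsub]
  exact sum_shareL hG hd (hcond z hz)

open scoped Classical in
/-- **Rows are exact**: every member receives exactly its local demand. -/
theorem sum_wLossFair_row {q : ℕ} {G : Finset α} (hG : G ∈ flatsQ M (q + 1))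
    (hd : (gr M \ G).card ≤ q)
    (hcond : ∀ B ∈ thinMembers M q G, ∀ z ∈ G \ clF M B,
      loss M q G B z ≤ rhoL M q G B z * lossIncome M q G B z)
    {B : Finset α} (hB : B ∈ membersIn M (Uq M (q + 2) q) G) :
    ∑ S ∈ shadowAt M (q + 2) q (Uq M (q + 2) q) G, wLossFair M q G B S =
      phiQ q * localWeight M B G := by
  have hBU : B ∈ Uq M (q + 2) q := (mem_membersIn.1 hB).1
  have hBG : clF M B ⊆ G := (mem_membersIn.1 hB).2
  have hc : ((gr M \ clF M B).card : ℚ) = ((G \ clF M B).card : ℚ) + ((gr M \ G).card : ℚ) := by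
    rw [card_compl_clF_add hG hBG]; push_cast; ring
  unfold wLossFair
  rw [Finset.sum_add_distrib, Finset.sum_add_distrib]
  by_cases hB0 : B ∈ lay0 M q G
  · rw [sum_w0_row_lay0 hG hB0]
    have hz1 : ∑ S ∈ shadowAt M (q + 2) q (Uq M (q + 2) q) G, w1 M q G B S = 0 := by
      apply Finset.sum_eq_zero; intro S _
      unfold w1; rw [if_neg]; intro h; exact h.1 hB0
    have hz2 : ∑ S ∈ shadowAt M (q + 2) q (Uq M (q + 2) q) G, w2F M q G B S = 0 := by
      apply Finset.sum_eq_zero; intro S _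
      unfold w2F; rw [if_neg]; intro h; exact (mem_thinMembers.1 h).2 hB0
    rw [hz1, hz2, add_zero, add_zero]
    unfold localWeight
    rw [(mem_lay0.1 hB0).2.1, hc, (mem_lay0.1 hB0).2.1]
    push_cast
    ring
  · have hBt : B ∈ thinMembers M q G := mem_thinMembers.2 ⟨hB, hB0⟩
    have hz0 : ∑ S ∈ shadowAt M (q + 2) q (Uq M (q + 2) q) G, w0 M q G B S = 0 := by
      apply Finset.sum_eq_zero; intro S _
      unfold w0; rw [if_neg]; intro h; exact hB0 h.1
    rw [hz0, zero_add, sum_w1_row hG hB hB0, sum_w2F_row hG hd hBt (hcond B hBt), ← Finset.sum_add_distrib]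
    have hterm : ∀ z ∈ G \ clF M B,
        req M q B * fS M q G (insert z B) + loss M q G B z = req M q B := by
      intro z _; unfold loss; ring
    rw [Finset.sum_congr rfl hterm, Finset.sum_const, nsmul_eq_mul]
    unfold req localWeight
    have hcpos : (0 : ℚ) < ((gr M \ clF M B).card : ℚ) := by
      have := two_le_card_compl_clF hBU
      exact_mod_cast (by omega : 0 < (gr M \ clF M B).card)
    field_simp

/-! ## Columns -/

open scoped Classical in
/-- Every share is at most the weight's share of `S`: `shareL B z S ≤ rhoL B z · cap2 S / pi2Mass S`. -/
theorem shareL_le {q : ℕ} {G : Finset α} (hG : G ∈ flatsQ M (q + 1)) (hd : (gr M \ G).card ≤ q)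
    {B : Finset α} {z : α} (hcond : loss M q G B z ≤ rhoL M q G B z * lossIncome M q G B z)
    (S : Finset α) :
    shareL M q G B z S ≤ rhoL M q G B z * (cap2 M q G S / pi2Mass M q G S) := by
  unfold shareL
  split_ifs with hl
  · exact mul_nonneg (rhoL_nonneg hG hd B z)
      (div_nonneg (cap2_nonneg (capS_nonneg' hG hd S)) (pi2Mass_nonneg hG hd S))
  · have hN : 0 < lossIncome M q G B z := (lossIncome_pos hG hd hl hcond).2
    have hq : loss M q G B z / lossIncome M q G B z ≤ rhoL M q G B z := by
      rw [div_le_iff₀ hN]; exact hcond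
    rw [show loss M q G B z * (cap2 M q G S / pi2Mass M q G S) / lossIncome M q G B z =
        (loss M q G B z / lossIncome M q G B z) * (cap2 M q G S / pi2Mass M q G S) by ring]
    exact mul_le_mul_of_nonneg_right hq
      (div_nonneg (cap2_nonneg (capS_nonneg' hG hd S)) (pi2Mass_nonneg hG hd S))

open scoped Classical in
/-- **The column bound**: the layer-2 column sum at `S` is at most `cap2 S`. -/
theorem sum_w2F_col_le {q : ℕ} {G : Finset α} (hG : G ∈ flatsQ M (q + 1)) (hd : (gr M \ G).card ≤ q)
    (hcond : ∀ B ∈ thinMembers M q G, ∀ z ∈ G \ clF M B,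
      loss M q G B z ≤ rhoL M q G B z * lossIncome M q G B z)
    (S : Finset α) :
    ∑ B ∈ membersIn M (Uq M (q + 2) q) G, w2F M q G B S ≤ cap2 M q G S := by
  have hcap : 0 ≤ cap2 M q G S := cap2_nonneg (capS_nonneg' hG hd S)
  have hPi : 0 ≤ pi2Mass M q G S := pi2Mass_nonneg hG hd S
  -- restrict to the thin members
  have hset : ∑ B ∈ membersIn M (Uq M (q + 2) q) G, w2F M q G B S =
      ∑ B ∈ thinMembers M q G,
        ∑ z ∈ G \ clF M B, if S ∈ tgtSets M q G B z then shareL M q G B z S else 0 := by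
    unfold w2F
    rw [← Finset.sum_filter]
    apply Finset.sum_congr
    · ext B
      rw [Finset.mem_filter, mem_thinMembers]
      tauto
    · intro B _; rfl
  rw [hset]
  -- termwise bound, then the mass identity
  calc ∑ B ∈ thinMembers M q G,
        ∑ z ∈ G \ clF M B, (if S ∈ tgtSets M q G B z then shareL M q G B z S else 0)
      ≤ ∑ B ∈ thinMembers M q G, ∑ z ∈ G \ clF M B,
          (if S ∈ tgtSets M q G B z then rhoL M q G B z * (cap2 M q G S / pi2Mass M q G S) else 0) := by
        apply Finset.sum_le_sum; intro B hB
        apply Finset.sum_le_sum; intro z hz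
        split_ifs
        · exact shareL_le hG hd (hcond B hB z hz) S
        · exact le_refl _
    _ = (cap2 M q G S / pi2Mass M q G S) * pi2Mass M q G S := by
        unfold pi2Mass
        rw [Finset.mul_sum]
        apply Finset.sum_congr rfl; intro B _
        rw [Finset.mul_sum]
        apply Finset.sum_congr rfl; intro z _
        split_ifs <;> ring
    _ ≤ cap2 M q G S := by
        rcases hPi.lt_or_eq with h | h
        · rw [div_mul_cancel₀ _ h.ne']
        · rw [← h, mul_zero]; exact hcap

open scoped Classical in
/-- The column sum of the rule at `S` is at most `1`. -/
theorem sum_wLossFair_col_le {q : ℕ} {G : Finset α} (hG : G ∈ flatsQ M (q + 1))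
    (hd : (gr M \ G).card ≤ q)
    (hcond : ∀ B ∈ thinMembers M q G, ∀ z ∈ G \ clF M B,
      loss M q G B z ≤ rhoL M q G B z * lossIncome M q G B z)
    (S : Finset α) :
    ∑ B ∈ membersIn M (Uq M (q + 2) q) G, wLossFair M q G B S ≤ 1 := by
  unfold wLossFair
  rw [Finset.sum_add_distrib, Finset.sum_add_distrib, sum_w0_col, sum_w1_col]
  have h := sum_w2F_col_le hG hd hcond S
  unfold cap2 capS at h
  have e : (k1 M q G S : ℚ) * (phiQ q / (1 + ((gr M \ G).card : ℚ))) =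
      (k1 M q G S : ℚ) * phiQ q / (1 + ((gr M \ G).card : ℚ)) := by ring
  rw [e]
  linarith

/-! ## The certificate -/

open scoped Classical in
/-- **The local form from the three-layer rule with fair-share loss routing.**  With `|E ∖ G| ≤ q`, if every
loss satisfies `loss B z ≤ rhoL B z · lossIncome B z`, then (LI_G) holds at `G`. -/
theorem localShadowHall_of_lossFair {q : ℕ} {G : Finset α} (hG : G ∈ flatsQ M (q + 1))
    (hd : (gr M \ G).card ≤ q)
    (hcond : ∀ B ∈ thinMembers M q G, ∀ z ∈ G \ clF M B,
      loss M q G B z ≤ rhoL M q G B z * lossIncome M q G B z) :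
    LocalShadowHall M q G := by
  apply localShadowHall_of_full_matching (wLossFair M q G)
  · intro B S
    unfold wLossFair
    exact add_nonneg (add_nonneg (w0_nonneg q G B S) (w1_nonneg (capS_nonneg' hG hd S) B))
      (w2F_nonneg hG hd B S)
  · exact fun B S h => subset_of_wLossFair_ne h
  · exact fun S _ => sum_wLossFair_col_le hG hd hcond S
  · intro B hB
    rw [sum_wLossFair_row hG hd hcond hB]
    exact le_refl _

end PercRepro.Shadow
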